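import Summits.AnomalousDissipation.AnomalousDissipation.Theorems.SawtoothPulseCascadeApproxProfileGaussian
import Summits.AnomalousDissipation.AnomalousDissipation.Theorems.SawtoothPulseCascadeApproxHeatCoefficients
import Mathlib.Analysis.SpecialFunctions.Gaussian.GaussianIntegral

/-!
# The forced heat profile driven by a rounded-sawtooth source: Fourier support and size
(route `AnomalousDissipation/SawtoothPulseCascade`; helper for the crux ApproxSol58 =
stmt-AnomalousDissipation-19688, registered stub `stub_responseL2` / S1 `stub_responseL2Envelope`:
the realignment pipeline, slot level)

On a half-slot `[a, b]` the parallel part of the forced linearised response created during the slot is a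
heat profile `F` from ZERO datum with the separated source `r(t) · κ u''(y)`, `u(y) = roundedSaw δ (2πNy)/(2πN)`
the (normalised) cascade profile (`K2Classical.exists_forcedParallel_H/_V`; `κ = ν`, `r = rateH_j`).  From
the coefficient identities of `…ApproxHeatCoefficients` and the profile coefficients of
`…ApproxProfileGaussian`:

* §1 the Gaussian sum over odd integers, `Σ_{n ∈ ℤ} e^{−a(2n+1)²} ≤ √(π/a)` (integral comparison);
* §2 `𝓕(F(t))(m) = 0` off the odd multiples of `N`; `‖𝓕(F(t))(m)‖ ≤ 6|κ|N (∫ₐᵗ|r|) e^{−δ²m²/(2N²)}`;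
  hence the pointwise size `|F(t, y)| ≤ 6√(2π) · |κ| N (∫ₐᵗ|r|) / δ` — for the cascade, `≈ 15 νγ N_j/δ_j`
  (resp. `/δ'` for the sharper realigned profile).
-/

set_option linter.dupNamespace false

noncomputable section

namespace Summit.AnomalousDissipation.AnomalousDissipation.Theorems.SawtoothPulseCascade.ApproxResponse

open Set MeasureTheory Complex
open scoped ContDiff
open Literature.Analysis Literature.Analysis.FunctionSpaces Literature.Analysis.FluidPDE
open Literature.Analysis.FluidPDE.SawtoothCascade
open Summit.AnomalousDissipation.AnomalousDissipation.Theorems.SawtoothPulseCascade.K2Classical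

/-! ## §1 The Gaussian sum over the odd integers -/

/-- `e^{−a(2k+1)²} ≤ ∫_k^{k+1} e^{−a x²} dx` for `k ∈ ℕ`, `a ≥ 0`. -/
theorem exp_neg_mul_odd_sq_le_integral {a : ℝ} (ha : 0 ≤ a) (k : ℕ) :
    Real.exp (-a * (2 * (k : ℝ) + 1) ^ 2) ≤ ∫ x in (k : ℝ)..(k + 1), Real.exp (-a * x ^ 2) := by
  have hk : (0 : ℝ) ≤ k := Nat.cast_nonneg k
  have hle : ∀ x ∈ Icc (k : ℝ) (k + 1), Real.exp (-a * (2 * (k : ℝ) + 1) ^ 2) ≤ Real.exp (-a * x ^ 2) := by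
    intro x hx
    apply Real.exp_le_exp.2
    have hx2 : x ^ 2 ≤ (2 * (k : ℝ) + 1) ^ 2 := by nlinarith [hx.1, hx.2]
    nlinarith
  have hcont : Continuous fun x : ℝ => Real.exp (-a * x ^ 2) :=
    Real.continuous_exp.comp (continuous_const.mul (continuous_pow 2))
  calc Real.exp (-a * (2 * (k : ℝ) + 1) ^ 2)
      = ∫ _ in (k : ℝ)..(k + 1), Real.exp (-a * (2 * (k : ℝ) + 1) ^ 2) := by
        rw [intervalIntegral.integral_const]; simp
    _ ≤ ∫ x in (k : ℝ)..(k + 1), Real.exp (-a * x ^ 2) :=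
        intervalIntegral.integral_mono_on (by linarith) _root_.intervalIntegrable_const
          (hcont.intervalIntegrable _ _) hle

/-- Partial sums of `e^{−a(2k+1)²}` over `k ∈ ℕ` are at most `√(π/a)/2` (`a > 0`). -/
theorem sum_range_exp_neg_mul_odd_sq_le {a : ℝ} (ha : 0 < a) (n : ℕ) :
    ∑ k ∈ Finset.range n, Real.exp (-a * (2 * (k : ℝ) + 1) ^ 2) ≤ Real.sqrt (Real.pi / a) / 2 := by
  have hcont : Continuous fun x : ℝ => Real.exp (-a * x ^ 2) :=
    Real.continuous_exp.comp (continuous_const.mul (continuous_pow 2))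
  have hint : IntegrableOn (fun x : ℝ => Real.exp (-a * x ^ 2)) (Ioi 0) := (integrable_exp_neg_mul_sq ha).integrableOn
  calc ∑ k ∈ Finset.range n, Real.exp (-a * (2 * (k : ℝ) + 1) ^ 2)
      ≤ ∑ k ∈ Finset.range n, ∫ x in (k : ℝ)..(k + 1), Real.exp (-a * x ^ 2) :=
        Finset.sum_le_sum fun k _ => exp_neg_mul_odd_sq_le_integral ha.le k
    _ = ∫ x in (0 : ℝ)..(n : ℝ), Real.exp (-a * x ^ 2) := by
        have h := intervalIntegral.sum_integral_adjacent_intervals (f := fun x : ℝ => Real.exp (-a * x ^ 2))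
          (μ := volume) (a := fun k : ℕ => (k : ℝ)) (n := n) (fun k _ => hcont.intervalIntegrable _ _)
        simp only [Nat.cast_zero, Nat.cast_succ] at h
        exact h
    _ ≤ ∫ x in Ioi (0 : ℝ), Real.exp (-a * x ^ 2) := by
        rw [intervalIntegral.integral_of_le (Nat.cast_nonneg n)]
        exact setIntegral_mono_set hint (ae_of_all _ fun x => (Real.exp_pos _).le)
          (ae_of_all _ Ioc_subset_Ioi_self)
    _ = Real.sqrt (Real.pi / a) / 2 := integral_gaussian_Ioi a

/-- **The Gaussian sum over the odd integers**: `Σ_{n ∈ ℤ} e^{−a(2n+1)²}` is summable and at most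
`√(π/a)` (`a > 0`). -/
theorem summable_exp_neg_mul_odd_sq {a : ℝ} (ha : 0 < a) :
    Summable (fun n : ℤ => Real.exp (-a * (2 * (n : ℝ) + 1) ^ 2)) ∧
      ∑' n : ℤ, Real.exp (-a * (2 * (n : ℝ) + 1) ^ 2) ≤ Real.sqrt (Real.pi / a) := by
  set f : ℤ → ℝ := fun n => Real.exp (-a * (2 * (n : ℝ) + 1) ^ 2) with hf
  have hnat : ∀ k : ℕ, f k = Real.exp (-a * (2 * (k : ℝ) + 1) ^ 2) := fun k => by simp [hf]
  have hneg : ∀ k : ℕ, f (-(k + 1 : ℕ)) = Real.exp (-a * (2 * (k : ℝ) + 1) ^ 2) := by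
    intro k
    simp only [hf]
    congr 1
    push_cast
    ring
  have hpos : ∀ k : ℕ, 0 ≤ Real.exp (-a * (2 * (k : ℝ) + 1) ^ 2) := fun k => (Real.exp_pos _).le
  have hs1 : Summable fun k : ℕ => f k := by
    simp_rw [hnat]; exact summable_of_sum_range_le hpos (sum_range_exp_neg_mul_odd_sq_le ha)
  have hs2 : Summable fun k : ℕ => f (-(k + 1)) := by
    have : (fun k : ℕ => f (-(k + 1))) = fun k : ℕ => Real.exp (-a * (2 * (k : ℝ) + 1) ^ 2) := by
      funext k; rw [← hneg k]; push_cast; rfl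
    rw [this]; exact summable_of_sum_range_le hpos (sum_range_exp_neg_mul_odd_sq_le ha)
  have ht1 : ∑' k : ℕ, f k ≤ Real.sqrt (Real.pi / a) / 2 := by
    simp_rw [hnat]; exact Real.tsum_le_of_sum_range_le hpos (sum_range_exp_neg_mul_odd_sq_le ha)
  have ht2 : ∑' k : ℕ, f (-(k + 1)) ≤ Real.sqrt (Real.pi / a) / 2 := by
    have : (fun k : ℕ => f (-(k + 1))) = fun k : ℕ => Real.exp (-a * (2 * (k : ℝ) + 1) ^ 2) := by
      funext k; rw [← hneg k]; push_cast; rfl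
    rw [this]; exact Real.tsum_le_of_sum_range_le hpos (sum_range_exp_neg_mul_odd_sq_le ha)
  refine ⟨Summable.of_nat_of_neg_add_one hs1 hs2, ?_⟩
  rw [tsum_of_nat_of_neg_add_one hs1 hs2]
  linarith


/-- `√(π/(δ²/2)) = √(2π)/δ` for `δ > 0`. -/
theorem sqrt_pi_div_half_sq {δ : ℝ} (hδ : 0 < δ) :
    Real.sqrt (Real.pi / (δ ^ 2 / 2)) = Real.sqrt (2 * Real.pi) / δ := by
  rw [show Real.pi / (δ ^ 2 / 2) = (2 * Real.pi) / δ ^ 2 by field_simp, Real.sqrt_div (by positivity),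
    Real.sqrt_sq hδ.le]

/-! ## §2 Forced heat profiles driven by the rounded-sawtooth source -/

/-- Scalars pull out of the profile coefficient: `𝓕(c·f)(m) = c 𝓕(f)(m)`. -/
theorem fourierCoeff_liftIco_const_mul (c : ℝ) (f : ℝ → ℝ) (m : ℤ) :
    fourierCoeff (AddCircle.liftIco 1 0 fun y => ((c * f y : ℝ) : ℂ)) m =
      (c : ℂ) * fourierCoeff (AddCircle.liftIco 1 0 fun y => (f y : ℂ)) m := by
  rw [fourierCoeff_liftIco_eq_integral, fourierCoeff_liftIco_eq_integral, ← intervalIntegral.integral_const_mul]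
  refine intervalIntegral.integral_congr fun y _ => ?_
  push_cast
  ring

/-- The normalised profile `u(y) = roundedSaw δ (2πNy)/(2πN)` is smooth. -/
theorem contDiff_profile {δ : ℝ} (hδ : 0 < δ) (N : ℕ) :
    ContDiff ℝ ∞ fun y : ℝ => roundedSaw δ (2 * Real.pi * N * y) / (2 * Real.pi * N) :=
  ((contDiff_roundedSaw hδ).comp (contDiff_const.mul contDiff_id)).div_const _

/-- The normalised profile is `1`-periodic (`N : ℕ`). -/
theorem periodic_profile (δ : ℝ) (N : ℕ) :
    Function.Periodic (fun y : ℝ => roundedSaw δ (2 * Real.pi * N * y) / (2 * Real.pi * N)) 1 := by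
  intro y
  show roundedSaw δ (2 * Real.pi * N * (y + 1)) / (2 * Real.pi * N) = roundedSaw δ (2 * Real.pi * N * y) / (2 * Real.pi * N)
  rw [show 2 * Real.pi * N * (y + 1) = 2 * Real.pi * N * y + N * (2 * Real.pi) by ring,
    (roundedSaw_periodic δ).nat_mul N]

/-- **Coefficients of the source `κ u''`**: `𝓕(κ u'')(m) = −4π²m²κ · 𝓕(u)(m)`. -/
theorem fourierCoeff_source {δ : ℝ} (hδ : 0 < δ) (N : ℕ) (κ : ℝ) (m : ℤ) :
    fourierCoeff (AddCircle.liftIco 1 0 fun y => ((κ * deriv (deriv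
        (fun y : ℝ => roundedSaw δ (2 * Real.pi * N * y) / (2 * Real.pi * N))) y : ℝ) : ℂ)) m =
      -(((4 * Real.pi ^ 2 * (m : ℝ) ^ 2 * κ : ℝ) : ℂ) *
        fourierCoeff (AddCircle.liftIco 1 0 fun y : ℝ =>
          ((roundedSaw δ (2 * Real.pi * N * y) / (2 * Real.pi * N) : ℝ) : ℂ)) m) := by
  rw [fourierCoeff_liftIco_const_mul, fourierCoeff_deriv_deriv (contDiff_profile hδ N) (periodic_profile δ N)]
  push_cast
  ring

/-- The source coefficient vanishes off the odd multiples of `N`. -/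
theorem fourierCoeff_source_eq_zero {δ : ℝ} (hδ : 0 < δ) {N : ℕ} (hN : N ≠ 0) (κ : ℝ) {m : ℤ}
    (hm : ¬ ∃ n : ℤ, m = (2 * n + 1) * (N : ℤ)) :
    fourierCoeff (AddCircle.liftIco 1 0 fun y => ((κ * deriv (deriv
        (fun y : ℝ => roundedSaw δ (2 * Real.pi * N * y) / (2 * Real.pi * N))) y : ℝ) : ℂ)) m = 0 := by
  rw [fourierCoeff_source hδ N κ m, fourierCoeff_profile_eq_zero hδ hN hm, mul_zero, neg_zero]

/-- **Bound of the source coefficients**: `‖𝓕(κ u'')(m)‖ ≤ 6|κ|N e^{−δ²m²/(2N²)}`. -/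
theorem norm_fourierCoeff_source_le {δ : ℝ} (hδ : 0 < δ) {N : ℕ} (hN : N ≠ 0) (κ : ℝ) (m : ℤ) :
    ‖fourierCoeff (AddCircle.liftIco 1 0 fun y => ((κ * deriv (deriv
        (fun y : ℝ => roundedSaw δ (2 * Real.pi * N * y) / (2 * Real.pi * N))) y : ℝ) : ℂ)) m‖ ≤
      6 * |κ| * N * Real.exp (-(δ ^ 2 * (m : ℝ) ^ 2 / (2 * (N : ℝ) ^ 2))) := by
  have hπ := Real.pi_pos
  have hN' : (0 : ℝ) < N := Nat.cast_pos.2 (Nat.pos_of_ne_zero hN)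
  by_cases hm : m = 0
  · subst hm
    rw [fourierCoeff_source hδ N κ 0]
    simp only [Int.cast_zero]
    rw [show ((4 * Real.pi ^ 2 * (0 : ℝ) ^ 2 * κ : ℝ) : ℂ) = 0 by push_cast; ring, zero_mul, neg_zero, norm_zero]
    positivity
  rw [fourierCoeff_source hδ N κ m, norm_neg, norm_mul, Complex.norm_real, Real.norm_eq_abs]
  have h1 := norm_fourierCoeff_profile_le hδ hN hm
  have hm' : (0 : ℝ) < (m : ℝ) ^ 2 := by
    have : (m : ℝ) ≠ 0 := by exact_mod_cast hm
    positivity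
  calc |4 * Real.pi ^ 2 * (m : ℝ) ^ 2 * κ| * ‖fourierCoeff (AddCircle.liftIco 1 0 fun y : ℝ =>
          ((roundedSaw δ (2 * Real.pi * N * y) / (2 * Real.pi * N) : ℝ) : ℂ)) m‖
      ≤ |4 * Real.pi ^ 2 * (m : ℝ) ^ 2 * κ| *
          (Real.exp (-(δ ^ 2 * (m : ℝ) ^ 2 / (2 * (N : ℝ) ^ 2))) * (3 * N / (2 * Real.pi ^ 2 * (m : ℝ) ^ 2))) :=
        mul_le_mul_of_nonneg_left h1 (abs_nonneg _)
    _ = 6 * |κ| * N * Real.exp (-(δ ^ 2 * (m : ℝ) ^ 2 / (2 * (N : ℝ) ^ 2))) := by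
        rw [abs_mul, abs_of_pos (by positivity : (0 : ℝ) < 4 * Real.pi ^ 2 * (m : ℝ) ^ 2)]
        field_simp
        ring

section Forced

variable {δ : ℝ} {N : ℕ} {ν κ a b : ℝ} {F : ℝ → ℝ → ℝ} {r : ℝ → ℝ}

/-- **Fourier support of the forced profile.**  Let `F` be a forced heat profile on `[a, b]` from zero
datum with source `r(t) · κ u''(y)`, `u(y) = roundedSaw δ (2πNy)/(2πN)` (`F` jointly smooth, `1`-periodic,
`∂ₜ|_{[a,b]} F = ν F'' + r κ u''`, `a < b`).  Then `𝓕(F(t))(m) = 0` unless `m` is an odd multiple of `N`. -/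
theorem fourierCoeff_forcedProfile_eq_zero (hδ : 0 < δ) (hN : N ≠ 0) (hab : a < b)
    (hF : ContDiffOn ℝ ∞ (Function.uncurry F) (Icc a b ×ˢ univ))
    (hper : ∀ t ∈ Icc a b, Function.Periodic (F t) 1) (hF0 : F a = fun _ => 0)
    (hr : ContDiff ℝ ∞ r)
    (heat : ∀ t ∈ Icc a b, ∀ y, derivWithin (fun τ => F τ y) (Icc a b) t =
      ν * deriv (deriv (F t)) y + r t * (κ * deriv (deriv
        (fun y : ℝ => roundedSaw δ (2 * Real.pi * N * y) / (2 * Real.pi * N))) y))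
    {m : ℤ} (hm : ¬ ∃ n : ℤ, m = (2 * n + 1) * (N : ℤ)) {t : ℝ} (ht : t ∈ Icc a b) :
    fourierCoeff (AddCircle.liftIco 1 0 fun y => (F t y : ℂ)) m = 0 := by
  have hV : ContDiff ℝ ∞ (fun y : ℝ => κ * deriv (deriv
      (fun y : ℝ => roundedSaw δ (2 * Real.pi * N * y) / (2 * Real.pi * N))) y) := by
    have := (contDiff_profile hδ N).iterate_deriv 2
    simpa using contDiff_const.mul this
  have hVper : Function.Periodic (fun y : ℝ => κ * deriv (deriv
      (fun y : ℝ => roundedSaw δ (2 * Real.pi * N * y) / (2 * Real.pi * N))) y) 1 := fun y => by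
    simp only [(ShearCascade.periodic_deriv (ShearCascade.periodic_deriv (periodic_profile δ N))) y]
  have H := fourierCoeff_heatProfile_forced hab hF hper hr hV hVper heat m ht
  rw [hF0, fourierCoeff_liftIco_zero, sub_zero, fourierCoeff_source_eq_zero hδ hN κ hm, mul_zero] at H
  have hE : ((Real.exp ((4 * Real.pi ^ 2 * ν * (m : ℝ) ^ 2) * (t - a)) : ℝ) : ℂ) ≠ 0 := by
    exact_mod_cast (Real.exp_pos _).ne'
  exact (mul_eq_zero.1 H).resolve_left hE

/-- **Coefficient bound of the forced profile** (`ν ≥ 0`):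
`‖𝓕(F(t))(m)‖ ≤ (∫ₐᵗ |r|) · 6|κ|N e^{−δ²m²/(2N²)}`. -/
theorem norm_fourierCoeff_forcedProfile_le (hδ : 0 < δ) (hN : N ≠ 0) (hab : a < b) (hν : 0 ≤ ν)
    (hF : ContDiffOn ℝ ∞ (Function.uncurry F) (Icc a b ×ˢ univ))
    (hper : ∀ t ∈ Icc a b, Function.Periodic (F t) 1) (hF0 : F a = fun _ => 0)
    (hr : ContDiff ℝ ∞ r)
    (heat : ∀ t ∈ Icc a b, ∀ y, derivWithin (fun τ => F τ y) (Icc a b) t =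
      ν * deriv (deriv (F t)) y + r t * (κ * deriv (deriv
        (fun y : ℝ => roundedSaw δ (2 * Real.pi * N * y) / (2 * Real.pi * N))) y))
    (m : ℤ) {t : ℝ} (ht : t ∈ Icc a b) :
    ‖fourierCoeff (AddCircle.liftIco 1 0 fun y => (F t y : ℂ)) m‖ ≤
      (∫ s in a..t, |r s|) * (6 * |κ| * N * Real.exp (-(δ ^ 2 * (m : ℝ) ^ 2 / (2 * (N : ℝ) ^ 2)))) := by
  have hV : ContDiff ℝ ∞ (fun y : ℝ => κ * deriv (deriv
      (fun y : ℝ => roundedSaw δ (2 * Real.pi * N * y) / (2 * Real.pi * N))) y) := by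
    have := (contDiff_profile hδ N).iterate_deriv 2
    simpa using contDiff_const.mul this
  have hVper : Function.Periodic (fun y : ℝ => κ * deriv (deriv
      (fun y : ℝ => roundedSaw δ (2 * Real.pi * N * y) / (2 * Real.pi * N))) y) 1 := fun y => by
    simp only [(ShearCascade.periodic_deriv (ShearCascade.periodic_deriv (periodic_profile δ N))) y]
  have H := norm_fourierCoeff_heatProfile_forced_le hab hν hF hper hr hV hVper heat hF0 m ht
  have hI : 0 ≤ ∫ s in a..t, |r s| := intervalIntegral.integral_nonneg ht.1 fun s _ => abs_nonneg _
  exact H.trans (mul_le_mul_of_nonneg_left (norm_fourierCoeff_source_le hδ hN κ m) hI)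

/-- **Pointwise size of the forced profile** (`ν ≥ 0`):
`|F(t, y)| ≤ 6√(2π) · |κ| N (∫ₐᵗ |r|) / δ` — the coefficients live on the odd multiples `(2n+1)N`, where
the Gaussian factor is `e^{−δ²(2n+1)²/2}`, and `Σ_n e^{−δ²(2n+1)²/2} ≤ √(2π)/δ`. -/
theorem abs_forcedProfile_le (hδ : 0 < δ) (hN : N ≠ 0) (hab : a < b) (hν : 0 ≤ ν)
    (hF : ContDiffOn ℝ ∞ (Function.uncurry F) (Icc a b ×ˢ univ))
    (hper : ∀ t ∈ Icc a b, Function.Periodic (F t) 1) (hF0 : F a = fun _ => 0)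
    (hr : ContDiff ℝ ∞ r)
    (heat : ∀ t ∈ Icc a b, ∀ y, derivWithin (fun τ => F τ y) (Icc a b) t =
      ν * deriv (deriv (F t)) y + r t * (κ * deriv (deriv
        (fun y : ℝ => roundedSaw δ (2 * Real.pi * N * y) / (2 * Real.pi * N))) y))
    {t : ℝ} (ht : t ∈ Icc a b) (y : ℝ) :
    |F t y| ≤ 6 * Real.sqrt (2 * Real.pi) * |κ| * N * (∫ s in a..t, |r s|) / δ := by
  have hN' : (0 : ℝ) < N := Nat.cast_pos.2 (Nat.pos_of_ne_zero hN)
  have hNz : (N : ℤ) ≠ 0 := by exact_mod_cast hN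
  set Γ : ℝ := ∫ s in a..t, |r s| with hΓ
  have hΓ0 : 0 ≤ Γ := intervalIntegral.integral_nonneg ht.1 fun s _ => abs_nonneg _
  set G : ℝ → ℂ := fun y => (F t y : ℂ) with hG
  have hct : Continuous (F t) := (contDiff_slice_of_contDiffOn_uncurry hF ht).continuous
  have hGc : Continuous G := Complex.continuous_ofReal.comp hct
  have hGper : Function.Periodic G 1 := fun y => by simp only [hG, hper t ht y]
  set c : ℤ → ℝ := fun m => ‖fourierCoeff (AddCircle.liftIco 1 0 G) m‖ with hc
  -- the coefficients are supported on the odd multiples `(2n+1)N`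
  set g : ℤ → ℤ := fun n => (2 * n + 1) * (N : ℤ) with hg
  have hginj : Function.Injective g := by
    intro n₁ n₂ h
    have := mul_right_cancel₀ hNz h
    omega
  have hsupp : ∀ m ∉ Set.range g, c m = 0 := by
    intro m hm
    have hm' : ¬ ∃ n : ℤ, m = (2 * n + 1) * (N : ℤ) := by
      rintro ⟨n, hn⟩
      exact hm ⟨n, hn.symm⟩
    simp only [hc, hG]
    rw [fourierCoeff_forcedProfile_eq_zero hδ hN hab hF hper hF0 hr heat hm' ht, norm_zero]
  -- termwise Gaussian bound along the odd multiples
  set a₀ : ℝ := δ ^ 2 / 2 with ha₀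
  have ha₀pos : 0 < a₀ := by rw [ha₀]; positivity
  have hterm : ∀ n : ℤ, c (g n) ≤ 6 * |κ| * N * Γ * Real.exp (-a₀ * (2 * (n : ℝ) + 1) ^ 2) := by
    intro n
    have h := norm_fourierCoeff_forcedProfile_le hδ hN hab hν hF hper hF0 hr heat (g n) ht
    have hexp : Real.exp (-(δ ^ 2 * ((g n : ℤ) : ℝ) ^ 2 / (2 * (N : ℝ) ^ 2))) =
        Real.exp (-a₀ * (2 * (n : ℝ) + 1) ^ 2) := by
      congr 1
      simp only [hg, ha₀]
      push_cast
      field_simp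
    rw [hexp] at h
    calc c (g n) ≤ Γ * (6 * |κ| * N * Real.exp (-a₀ * (2 * (n : ℝ) + 1) ^ 2)) := h
      _ = 6 * |κ| * N * Γ * Real.exp (-a₀ * (2 * (n : ℝ) + 1) ^ 2) := by ring
  obtain ⟨hsum_odd, htsum_odd⟩ := summable_exp_neg_mul_odd_sq ha₀pos
  have hmaj : Summable fun n : ℤ => 6 * |κ| * N * Γ * Real.exp (-a₀ * (2 * (n : ℝ) + 1) ^ 2) :=
    hsum_odd.mul_left _
  have hcg : Summable (c ∘ g) :=
    Summable.of_nonneg_of_le (fun n => norm_nonneg _) hterm hmaj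
  have hcs : Summable c := (hginj.summable_iff hsupp).1 hcg
  -- assemble
  have hpt := norm_le_tsum_norm_fourierCoeff hGc hGper hcs y
  have hGy : ‖G y‖ = |F t y| := by simp only [hG, Complex.norm_real, Real.norm_eq_abs]
  rw [hGy] at hpt
  refine hpt.trans ?_
  change ∑' m, c m ≤ _
  have hsupp' : Function.support c ⊆ Set.range g := by
    intro m hm
    by_contra h
    exact hm (hsupp m h)
  rw [← hginj.tsum_eq hsupp']
  have hK : 0 ≤ 6 * |κ| * N * Γ := by positivity
  calc ∑' n, c (g n) ≤ ∑' n : ℤ, 6 * |κ| * N * Γ * Real.exp (-a₀ * (2 * (n : ℝ) + 1) ^ 2) :=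
        Summable.tsum_le_tsum hterm hcg hmaj
    _ = 6 * |κ| * N * Γ * ∑' n : ℤ, Real.exp (-a₀ * (2 * (n : ℝ) + 1) ^ 2) := tsum_mul_left
    _ ≤ 6 * |κ| * N * Γ * Real.sqrt (Real.pi / a₀) := mul_le_mul_of_nonneg_left htsum_odd hK
    _ = 6 * Real.sqrt (2 * Real.pi) * |κ| * N * Γ / δ := by
        rw [ha₀, sqrt_pi_div_half_sq hδ]
        ring

end Forced

end Summit.AnomalousDissipation.AnomalousDissipation.Theorems.SawtoothPulseCascade.ApproxResponse

end
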